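import Mathlib.Data.Complex.Basic
import Summits.ValiantsHypothesis.ValiantsHypothesis.Theorems.GrenetZeonHessianRankCodimTwoReduceModP
import HarnessLib

/-!
# Transfer of non-vanishing counts from characteristic `p` to characteristic `0`

Crux `HessianRankCodimTwo` (stmt-ValiantsHypothesis-8061), line `good_plane`: design-agnostic form of
the PART C assembly of Theorem P (`…LatinAssembly.lean`), for the bordered / higher variants
(Theorem P′ of `Cruxes/HessianRankCodimTwo/GoodPlanesLatinReduction.md` §10, the `m = kp` families
of §6).  If `Φ` and a finite family `Ψ i` of homogeneous integer forms in three variables satisfy,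
over EVERY field of characteristic `p`, "at each non-zero zero of `Φ` at least `N` of the `Ψ i` are
non-zero", then the same holds over `ℂ` (`le_card_ne_zero_of_charP`): otherwise the vanishing `Ψ i`
together with `Φ` have a common non-trivial complex zero, which reduces modulo `p`
(`exists_charP_commonZero`).  VP ≠ VNP is not moved.
-/

noncomputable section

open MvPolynomial Finset

-- single-conjunct layout `Summits/ValiantsHypothesis/ValiantsHypothesis`: duplicated namespace by design
set_option linter.dupNamespace false

namespace Summit.ValiantsHypothesis.ValiantsHypothesis.Theorems.GrenetZeonHessianRankCodimTwo

/-- **Transfer of non-vanishing counts.** Let `Φ`, `Ψ i` (`i : ι`, finite) be homogeneous integer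
forms in `σ` variables and `p` a prime.  If over every field `L` of characteristic `p`, at every
`w ≠ 0` with `Φ(w) = 0` at least `N` of the values `Ψ i (w)` are non-zero, then at every `a ≠ 0` in
`ℂ^σ` with `Φ(a) = 0` at least `N` of the values `Ψ i (a)` are non-zero. [folklore] -/
theorem le_card_ne_zero_of_charP {σ : Type} [Fintype σ] {ι : Type} [Fintype ι] [DecidableEq ι]
    (Φ : MvPolynomial σ ℤ) (Ψ : ι → MvPolynomial σ ℤ) (dΦ : ℕ) (dΨ : ι → ℕ)
    (hΦ : Φ.IsHomogeneous dΦ) (hΨ : ∀ i, (Ψ i).IsHomogeneous (dΨ i)) {p : ℕ} (hp : p.Prime) (N : ℕ)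
    (hchar : ∀ (L : Type) [Field L] [CharP L p] [DecidableEq L] (w : σ → L), w ≠ 0 →
      aeval w Φ = 0 → N ≤ (Finset.univ.filter fun i => aeval w (Ψ i) ≠ 0).card)
    (a : σ → ℂ) (ha : a ≠ 0) (hΦa : aeval a Φ = 0) :
    N ≤ (Finset.univ.filter fun i => aeval a (Ψ i) ≠ 0).card := by
  classical
  by_contra hlt
  push Not at hlt
  -- the vanishing family, together with `Φ`, has the common zero `a`
  set S := Finset.univ.filter fun i => aeval a (Ψ i) = 0 with hS
  let f : Option S → MvPolynomial σ ℤ := fun o => o.elim Φ fun i => Ψ i.1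
  let d : Option S → ℕ := fun o => o.elim dΦ fun i => dΨ i.1
  have hfhom : ∀ o, (f o).IsHomogeneous (d o) := by
    rintro (_ | i)
    · exact hΦ
    · exact hΨ _
  have hfzero : ∀ o, aeval a (f o) = 0 := by
    rintro (_ | ⟨i, hi⟩)
    · exact hΦa
    · simp only [hS, Finset.mem_filter, Finset.mem_univ, true_and] at hi
      exact hi
  obtain ⟨L, _instF, _instC, w, hw, hfw⟩ := exists_charP_commonZero f d hfhom a ha hfzero p hp
  letI : DecidableEq L := Classical.decEq L
  have hΦw : aeval w Φ = 0 := hfw none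
  have hΨw : ∀ i ∈ S, aeval w (Ψ i) = 0 := fun i hi => hfw (some ⟨i, hi⟩)
  -- count: the non-vanishing `Ψ i (w)` lie outside `S`
  have hsub : (Finset.univ.filter fun i => aeval w (Ψ i) ≠ 0) ⊆
      Finset.univ.filter fun i => aeval a (Ψ i) ≠ 0 := by
    intro i hi
    simp only [Finset.mem_filter, Finset.mem_univ, true_and] at hi ⊢
    intro hai
    exact hi (hΨw i (by simp [hS, hai]))
  have := (hchar L w hw hΦw).trans (Finset.card_le_card hsub)
  omega

end Summit.ValiantsHypothesis.ValiantsHypothesis.Theorems.GrenetZeonHessianRankCodimTwo
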